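import Summits.QuantumFields.QCD.Theses.QuarksAsStableAction
import Summits.QuantumFields.QCD.Theorems.QuarksAsStableActionStableActionBridgeProjChainDet
import Summits.QuantumFields.QCD.Theorems.QuarksAsStableActionStableActionBridgeTimeSlice
import Summits.QuantumFields.QCD.Theorems.QuarksAsStableActionStableActionBridgeProjChainBlock
import Summits.QuantumFields.QCD.Theorems.QuarksAsStableActionStableActionBridgeSliceMassHop
import Summits.QuantumFields.QCD.Theorems.QuarksAsStableActionStableActionBridgeSliceSpin

/-!
# Time-slice reduction of the Wilson fermion determinant (F3-core, Wilson instance)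
(crux `QuarksAsStableAction.StableActionBridge`, item stmt-QuantumFields-9737, line `Sketch`; lead helper of
continuation lead c2, cycle 3, `--supports stmt-QuantumFields-9737`)

**Theorem `wilson_det_slice_reduction`.**  For every unitary representation `ρ : G → U(N_c)`, every gauge
field `U` on the four-torus `(ℤ/L)⁴` (`L ≥ 1`), and every bare mass `m > −1` (hopping parameter `κ < 1/6`,
Lüscher's condition), the determinant of the tree's `r = 1` Wilson–Dirac matrix `wilsonDirac ρ U m 1` on
`(ℤ/L)⁴ × colour × spin` equals a determinant on ONE TIME SLICE:

  `det D_W[U] = (∏_{t ∈ ℤ/L} det E_t) · det(1 − (−1)^L ∏_{t=0}^{L−1} E_t⁻¹ F_t)`,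

with the explicit slice blocks (`P± = ½(1 ± γ₀)` on spin, `A_t` = mass + spatial Wilson hops of slice `t`,
`W_t = ρ(U((t,·),0))` the forward temporal links, `W′_t = ρ(U((t,·),0)⁻¹)`):
`E_t = A_t P⁻ − P⁺ W′_{t−1}`, `F_t = A_t P⁺ − P⁻ W_t`.  This is the finite-dimensional fermionic core of
Lüscher's transfer-matrix construction (the Grassmann integral over all but one time slice done exactly): with the
tree's `trace_Gamma : Tr Γ(g) = det(1 + g)` the right-hand side is a Fock-space trace of the ordered product of
one-step transfer matrices.  Boundary conditions in time enter only through the links `U((L−1,·),0)` (the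
antiperiodic family of the route = sign-flipped seam links), so the same formula serves the `(−1)^F`-twisted
(periodic) and the thermal (antiperiodic) determinants.

Assembly (no new mathematics here) of the landed bricks: `wilsonDirac_submatrix_timeSlice` (p116756: splitting
`x = Fin.cons t y` exhibits `D_W` as a projector chain), `det_projChain` (abstract chain determinant, from
`projChain_mul_shiftSubst` p114817, `det_shiftSubst_spin_eq_one` p114979, `det_blockDiag_add_blockShift` p115737),
`wilsonSlice_spin_structure` (p117675: `P⁻A_tP⁻ = (B_t ⊗ 1)P⁻`, commutations, `det(B_t ⊗ 1) = (det B_t)⁴`,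
`W′W = 1`), `isUnit_det_sliceMassHop` (p116505: `B_t` invertible for `m > −1`, unitary `ρ`),
`isUnit_det_projChainBlock` (p116372: hence `E_t` invertible).

References: M. Lüscher, Commun. Math. Phys. 54 (1977) 283 [Luscher1977, pp. 283–292]; I. Montvay, G. Münster,
*Quantum Fields on a Lattice* §4.2 (4.85), §4.2.3 (4.111) [MontvayMunster1994]; J. Smit, *Introduction to Quantum
Fields on a Lattice* §6.5.
-/

namespace Summit.QuantumFields.QCD.Cruxes.StableActionBridge.Sketch

open Literature.MathematicalPhysics.QuantumLattice Literature.MathematicalPhysics.QuantumFieldTheory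
open Literature.Probability.LatticeModels (TorusSite)

/-- The time-splitting equivalence `(t, (y, c)) ↦ (Fin.cons t y, c)` between `ℤ/L × ((ℤ/L)³ × colour × spin)`
and `(ℤ/L)⁴ × colour × spin`. -/
theorem timeSplitEquiv_apply (Nc L : ℕ) (p : ZMod L × (TorusSite 3 L × Fin Nc × Fin 4)) :
    ((Equiv.prodAssoc (ZMod L) (TorusSite 3 L) (Fin Nc × Fin 4)).symm.trans
        ((Fin.consEquiv fun _ : Fin 4 => ZMod L).prodCongr (Equiv.refl (Fin Nc × Fin 4)))) p =
      ((Fin.cons p.1 p.2.1 : TorusSite 4 L), p.2.2) := rfl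

/-- **Time-slice reduction of the Wilson fermion determinant** (registered sub-goal `wilson_det_slice_reduction`
of crux stmt-QuantumFields-9737; F3-core, Wilson instance).  See the module docstring. -/
theorem wilson_det_slice_reduction :
    ∀ (Nc L : ℕ) [NeZero L] (G : Type) [Group G] (ρ : G →* Matrix (Fin Nc) (Fin Nc) ℂ),
      (∀ g, ρ g ∈ Matrix.unitaryGroup (Fin Nc) ℂ) → ∀ (U : GaugeConfig 4 L G) (m : ℝ), -1 < m →
      let Pp : Matrix (TorusSite 3 L × Fin Nc × Fin 4) (TorusSite 3 L × Fin Nc × Fin 4) ℂ := Matrix.of fun a b =>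
        if a.1 = b.1 ∧ a.2.1 = b.2.1 then ((1 / 2 : ℂ) • (1 + euclideanGamma 0)) a.2.2 b.2.2 else 0;
      let Pm : Matrix (TorusSite 3 L × Fin Nc × Fin 4) (TorusSite 3 L × Fin Nc × Fin 4) ℂ := Matrix.of fun a b =>
        if a.1 = b.1 ∧ a.2.1 = b.2.1 then ((1 / 2 : ℂ) • (1 - euclideanGamma 0)) a.2.2 b.2.2 else 0;
      let W : ZMod L → Matrix (TorusSite 3 L × Fin Nc × Fin 4) (TorusSite 3 L × Fin Nc × Fin 4) ℂ := fun t =>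
        Matrix.of fun a b => if a.1 = b.1 ∧ a.2.2 = b.2.2 then
          ρ (U ((Fin.cons t a.1 : TorusSite 4 L), 0)) a.2.1 b.2.1 else 0;
      let W' : ZMod L → Matrix (TorusSite 3 L × Fin Nc × Fin 4) (TorusSite 3 L × Fin Nc × Fin 4) ℂ := fun t =>
        Matrix.of fun a b => if a.1 = b.1 ∧ a.2.2 = b.2.2 then
          ρ (U ((Fin.cons t a.1 : TorusSite 4 L), 0))⁻¹ a.2.1 b.2.1 else 0;
      let A : ZMod L → Matrix (TorusSite 3 L × Fin Nc × Fin 4) (TorusSite 3 L × Fin Nc × Fin 4) ℂ := fun t =>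
        Matrix.of fun a b =>
          (if a = b then ((m + 4 * 1 : ℝ) : ℂ) else 0) -
            (1 / 2 : ℂ) * ∑ j : Fin 3,
              ((if b.1 = Literature.MathematicalPhysics.QuantumFieldTheory.Site.shift a.1 j then
                  (((1 : ℝ) : ℂ) • (1 : Matrix (Fin 4) (Fin 4) ℂ) - euclideanGamma j.succ) a.2.2 b.2.2 *
                    ρ (U ((Fin.cons t a.1 : TorusSite 4 L), j.succ)) a.2.1 b.2.1 else 0) +
                (if a.1 = Literature.MathematicalPhysics.QuantumFieldTheory.Site.shift b.1 j then
                  (((1 : ℝ) : ℂ) • (1 : Matrix (Fin 4) (Fin 4) ℂ) + euclideanGamma j.succ) a.2.2 b.2.2 *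
                    ρ (U ((Fin.cons t b.1 : TorusSite 4 L), j.succ))⁻¹ a.2.1 b.2.1 else 0));
      (wilsonDirac ρ U m 1).det =
        (∏ t : ZMod L, (A t * Pm - Pp * W' (t - 1)).det) *
          (1 - (-1 : ℂ) ^ L •
            ((List.range L).map fun i : ℕ =>
              (A (i : ZMod L) * Pm - Pp * W' ((i : ZMod L) - 1))⁻¹ *
                (A (i : ZMod L) * Pp - Pm * W (i : ZMod L))).prod).det := by
  intro Nc L _ G _ ρ hρ U m hm Pp Pm W W' A
  -- (1) the abstract chain determinant, with its hypotheses supplied by the spin-structure bricks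
  have hspin := fun t : ZMod L => wilsonSlice_spin_structure Nc L G ρ U m t
  have hchain := det_projChain L (TorusSite 3 L) Nc A W W'
    (fun t => (hspin t).2.2.2.2.1) (fun t => (hspin t).2.2.2.2.2.1)
    (fun t => (hspin t).2.2.2.2.2.2.1) (fun t => (hspin t).2.2.2.2.2.2.2.1)
    (fun t => by
      obtain ⟨hPAP, hBP, -, hdetB, -, -, hW'p, -, hW'W⟩ := hspin (t - 1)
      obtain ⟨hPAP', hBP', -, hdetB', -, -, -, -, -⟩ := hspin t
      refine isUnit_det_projChainBlock (TorusSite 3 L × Fin Nc × Fin 4) (A t) _ (W' (t - 1)) Pp Pm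
        (liftProjPlus_add_liftProjMinus (TorusSite 3 L) Nc) (liftProjPlus_mul_liftProjMinus (TorusSite 3 L) Nc)
        (liftProjMinus_mul_liftProjPlus (TorusSite 3 L) Nc) hPAP' hBP' ?_ hW'p
        (Matrix.isUnit_det_of_right_inverse hW'W)
      rw [hdetB']
      exact (isUnit_det_sliceMassHop Nc L G ρ hρ U m hm t).pow 4)
  -- (2) the Wilson–Dirac matrix, reindexed along the time splitting, IS that chain
  have hslice := wilsonDirac_submatrix_timeSlice Nc L G ρ U m
  -- (3) reindexing along an equivalence does not change the determinant
  have hdet : (wilsonDirac ρ U m 1).det =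
      ((wilsonDirac ρ U m 1).submatrix
        (fun p : ZMod L × (TorusSite 3 L × Fin Nc × Fin 4) => ((Fin.cons p.1 p.2.1 : TorusSite 4 L), p.2.2))
        (fun p : ZMod L × (TorusSite 3 L × Fin Nc × Fin 4) => ((Fin.cons p.1 p.2.1 : TorusSite 4 L), p.2.2))).det := by
    rw [← Matrix.det_submatrix_equiv_self
      ((Equiv.prodAssoc (ZMod L) (TorusSite 3 L) (Fin Nc × Fin 4)).symm.trans
        ((Fin.consEquiv fun _ : Fin 4 => ZMod L).prodCongr (Equiv.refl (Fin Nc × Fin 4))))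
      (wilsonDirac ρ U m 1)]
    rfl
  rw [hdet, hslice]
  exact hchain

end Summit.QuantumFields.QCD.Cruxes.StableActionBridge.Sketch
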